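import Summits.Ventures.Crystal3D.Theorems.StickyWulffConstantCoaxialWallLawInPlaneStackWalkers
import Summits.Ventures.Crystal3D.Theorems.StickyWulffConstantGenericWallFloorCoaxialIff
import Summits.Ventures.Crystal3D.Theorems.StickyWulffConstantGenericWallFloorHexSteering
import HarnessLib

/-!
# Lane F's cell inequality at charge `½ sin θ` for EVERY twin pair with `(√3/2) sin θ ≥ 13/25`, ARBITRARY fillings
# (crux `CoaxialWallLaw`, stmt-Ventures-19481, line `WallLedgerF`; in-plane stack walkers of lane G)

HONEST FRAMING. Venture `Summits/Ventures/Crystal3D` (cell `crystal3d-full`), helper `--supports` the crux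
`CoaxialWallLaw` of `route-Ventures-StickyWulffConstant` (registered line `WallLedgerF`, open stub
`stub_coaxialTwoSlabAdhesion`).  Rung credit only; F-C1 not moved; NOT the stub: translation pairs (equal LINEAR lattices)
and twin pairs with `sin θ < 26/(25√3) ≈ 0.60` are not covered, and `ExactOnly`(C12-55) [E1], `StarPairFar` (lane G's two
certified computations) are inputs BY NAME.

`…CoaxialWallLawInPlaneStackWalkers` (19480-p1 g7) gives, for a twin pair presented as `A₂·Λ₀ = (wordFrame A₁ [μ])·Λ₀` and
an in-plane slot of `e₃`-component `≥ 13/25`, the clamped-cell inequality at charge `½·s` for every `s ≤ √2⟪A₁d, e₃⟫`.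
This file packages it in lane F's own terms:

* from lane F's hypotheses (co-axial pair, here with DIFFERENT linear lattices) the pair is a mirror twin about a unit menu
  normal `ν` of grain 1 (`eq_or_twin_of_coaxial`), and `θ = ∠(ν, e₃)` is lane F's angle (`sin θ = √(1 − ⟪ν, e₃⟫²)`);
* the steepest in-plane slot of grain 1 has `e₃`-component `≥ (√3/2) sin θ` (`exists_inPlane_slot_ge`, the hexagon bound);
* **`coaxialTwin_twoSlabLedger_half_sin`** — hence, whenever `(√3/2) sin θ ≥ 13/25`, `TwoSlabLedgerAt (½ sin θ) A₁ t₁ A₂ t₂`: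
  lane F's stub inequality for this pair, ARBITRARY fillings, residual-free (in fact at charge `(√6/4) sin θ ≥ 0.61 sin θ`,
  `coaxialTwin_twoSlabLedger_sharp`).
For Haar-random twin orientations `cos θ` is uniform, so the tilt condition `sin θ ≥ 0.6004` holds for `80 %` of them.
WHAT THIS IS NOT: not `stub_coaxialTwoSlabAdhesion` (its `∃ L` packaging with `L e₃ = ±ν`, translation pairs and shallow
twins remain for the F seats); F-C1 not moved.
-/

noncomputable section

namespace Summit.Ventures.Crystal3D.Theorems

open Summit.Ventures.Crystal3D Finset
open Literature.MathematicalPhysics.StatisticalMechanics (fccStacking barlowStacking IsHaggSeq contactDeficiency)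
open scoped InnerProductSpace

/-- **The steepest in-plane slot**: for a unit menu normal `ν` of the frame `A` with `⟪ν, e₃⟫² < 1`, some slot `w` IN the
plane (`⟪A w, ν⟫ = 0`) has `e₃`-component `≥ (√3/2)·√(1 − ⟪ν, e₃⟫²)`. -/
theorem exists_inPlane_slot_ge_sin (A : EuclideanSpace ℝ (Fin 3) ≃ₗᵢ[ℝ] EuclideanSpace ℝ (Fin 3))
    {ν : EuclideanSpace ℝ (Fin 3)} (hν : ‖ν‖ = 1)
    (hmenu : ∀ w ∈ fccSlots, ⟪A w, ν⟫_ℝ = 0 ∨ ⟪A w, ν⟫_ℝ = Real.sqrt (2 / 3) ∨ ⟪A w, ν⟫_ℝ = -Real.sqrt (2 / 3))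
    (hlt : ⟪ν, EuclideanSpace.single (2 : Fin 3) (1 : ℝ)⟫_ℝ ^ 2 < 1) :
    ∃ w ∈ fccSlots, ⟪A w, ν⟫_ℝ = 0 ∧
      Real.sqrt 3 / 2 * Real.sqrt (1 - ⟪ν, EuclideanSpace.single (2 : Fin 3) (1 : ℝ)⟫_ℝ ^ 2) ≤
        ⟪A w, EuclideanSpace.single (2 : Fin 3) (1 : ℝ)⟫_ℝ := by
  set e : EuclideanSpace ℝ (Fin 3) := EuclideanSpace.single (2 : Fin 3) (1 : ℝ) with he
  have hen : ‖e‖ = 1 := by rw [he, PiLp.norm_single, norm_one]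
  set c : ℝ := ⟪ν, e⟫_ℝ with hc
  set p : EuclideanSpace ℝ (Fin 3) := e - c • ν with hp
  have hνν : ⟪ν, ν⟫_ℝ = 1 := by rw [real_inner_self_eq_norm_sq, hν]; norm_num
  have hpν : ⟪p, ν⟫_ℝ = 0 := by
    rw [hp, inner_sub_left, real_inner_smul_left, hνν, real_inner_comm, ← hc]; ring
  have hpsq : ‖p‖ ^ 2 = 1 - c ^ 2 := by
    rw [← real_inner_self_eq_norm_sq, hp, inner_sub_left, inner_sub_right, inner_sub_right, real_inner_smul_left,
      real_inner_smul_right, real_inner_smul_left, real_inner_smul_right, real_inner_self_eq_norm_sq, hen, hνν,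
      real_inner_comm ν e, ← hc]
    ring
  have hpos : 0 < 1 - c ^ 2 := by linarith
  set r : ℝ := Real.sqrt (1 - c ^ 2) with hr
  have hr0 : 0 < r := Real.sqrt_pos.2 hpos
  have hrp : ‖p‖ = r := by
    rw [hr, ← hpsq, Real.sqrt_sq (norm_nonneg _)]
  set g : EuclideanSpace ℝ (Fin 3) := r⁻¹ • p with hg
  have hgn : ‖g‖ = 1 := by
    rw [hg, norm_smul, Real.norm_eq_abs, abs_of_pos (inv_pos.2 hr0), hrp, inv_mul_cancel₀ hr0.ne']
  have hgν : ⟪g, ν⟫_ℝ = 0 := by rw [hg, real_inner_smul_left, hpν, mul_zero]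
  obtain ⟨w, hw, hwν, hwg⟩ := exists_inPlane_slot_ge A hν hmenu hgn hgν
  refine ⟨w, hw, hwν, ?_⟩
  -- `⟪A w, e⟫ = r ⟪A w, g⟫` since `e = p + c ν = r g + c ν` and `⟪A w, ν⟫ = 0`
  have hdecomp : e = r • g + c • ν := by
    rw [hg, smul_smul, mul_inv_cancel₀ hr0.ne', one_smul, hp]; abel
  have hwe : ⟪A w, e⟫_ℝ = r * ⟪A w, g⟫_ℝ := by
    rw [hdecomp, inner_add_right, real_inner_smul_right (A w) g r, real_inner_smul_right (A w) ν c, hwν, mul_zero,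
      add_zero]
  rw [hwe]
  have := mul_le_mul_of_nonneg_left hwg hr0.le
  linarith

open scoped Classical in
/-- **Twin pairs in lane F's terms, sharp charge.**  A co-axial pair with DIFFERENT linear lattices is a mirror twin about a
unit menu normal `ν` of grain 1; if `(√3/2)·√(1 − ⟪ν,e₃⟫²) ≥ 13/25` then the clamped-cell inequality holds at charge
`(√6/4)·√(1 − ⟪ν,e₃⟫²)`, ARBITRARY fillings, modulo `ExactOnly`(C12-55) and `StarPairFar`. -/
theorem coaxialTwin_twoSlabLedger_sharp
    {s₀ : EuclideanSpace ℝ (Fin 3)} (hs₀ : s₀ ∈ fccSlots)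
    (hcert : ExactOnly 0 (fccSlots.filter fun w => 0 < ⟪w, s₀⟫_ℝ)) (hfar : StarPairFar)
    (A₁ : EuclideanSpace ℝ (Fin 3) ≃ₗᵢ[ℝ] EuclideanSpace ℝ (Fin 3)) (t₁ : EuclideanSpace ℝ (Fin 3))
    (A₂ : EuclideanSpace ℝ (Fin 3) ≃ₗᵢ[ℝ] EuclideanSpace ℝ (Fin 3)) (t₂ : EuclideanSpace ℝ (Fin 3))
    (hco : ∃ (L : EuclideanSpace ℝ (Fin 3) ≃ₗᵢ[ℝ] EuclideanSpace ℝ (Fin 3))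
        (s₁ s₂ : EuclideanSpace ℝ (Fin 3)) (σ σ' : ℤ → ℤ), IsHaggSeq σ ∧ IsHaggSeq σ' ∧
        (fun p => A₁ p + t₁) '' fccStacking 1 (Real.sqrt (2 / 3)) ⊆
          (fun p => L p + s₁) '' barlowStacking 1 (Real.sqrt (2 / 3)) σ ∧
        (fun p => A₂ p + t₂) '' fccStacking 1 (Real.sqrt (2 / 3)) ⊆
          (fun p => L p + s₂) '' barlowStacking 1 (Real.sqrt (2 / 3)) σ')
    (hne : A₁ '' fccStacking 1 (Real.sqrt (2 / 3)) ≠ A₂ '' fccStacking 1 (Real.sqrt (2 / 3))) :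
    ∃ ν : EuclideanSpace ℝ (Fin 3), ‖ν‖ = 1 ∧
      (∀ w ∈ fccSlots, ⟪A₁ w, ν⟫_ℝ = 0 ∨ ⟪A₁ w, ν⟫_ℝ = Real.sqrt (2 / 3) ∨ ⟪A₁ w, ν⟫_ℝ = -Real.sqrt (2 / 3)) ∧
      A₂ '' fccStacking 1 (Real.sqrt (2 / 3)) = twinFrame A₁ ν '' fccStacking 1 (Real.sqrt (2 / 3)) ∧
      ((13 / 25 : ℝ) ≤ Real.sqrt 3 / 2 * Real.sqrt (1 - ⟪ν, EuclideanSpace.single (2 : Fin 3) (1 : ℝ)⟫_ℝ ^ 2) →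
        TwoSlabLedgerAt (Real.sqrt 6 / 4 * Real.sqrt (1 - ⟪ν, EuclideanSpace.single (2 : Fin 3) (1 : ℝ)⟫_ℝ ^ 2))
          A₁ t₁ A₂ t₂) := by
  -- linear co-axiality and the twin normal
  have hco0 := coaxial_translate A₁ A₂ t₁ t₂ 0 0 hco
  have h1 : (fun p : EuclideanSpace ℝ (Fin 3) => A₁ p + 0) = (A₁ : EuclideanSpace ℝ (Fin 3) → EuclideanSpace ℝ (Fin 3)) :=
    funext fun p => add_zero _
  have h2 : (fun p : EuclideanSpace ℝ (Fin 3) => A₂ p + 0) = (A₂ : EuclideanSpace ℝ (Fin 3) → EuclideanSpace ℝ (Fin 3)) :=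
    funext fun p => add_zero _
  rw [h1, h2] at hco0
  rcases eq_or_twin_of_coaxial A₁ A₂ hco0 with heq | ⟨ν, hν, hmenu, htwin⟩
  · exact absurd heq hne
  refine ⟨ν, hν, hmenu, htwin, fun htilt => ?_⟩
  set e : EuclideanSpace ℝ (Fin 3) := EuclideanSpace.single (2 : Fin 3) (1 : ℝ) with he
  have h3pos : 0 < Real.sqrt 3 := Real.sqrt_pos.2 (by norm_num)
  have hsq0 : 0 ≤ Real.sqrt (1 - ⟪ν, e⟫_ℝ ^ 2) := Real.sqrt_nonneg _
  -- the tilt condition forces `⟪ν, e⟫² < 1`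
  have hlt : ⟪ν, e⟫_ℝ ^ 2 < 1 := by
    by_contra hge
    push Not at hge
    have : Real.sqrt (1 - ⟪ν, e⟫_ℝ ^ 2) = 0 := Real.sqrt_eq_zero'.2 (by linarith)
    rw [this, mul_zero] at htilt
    norm_num at htilt
  obtain ⟨w, hw, hwν, hwe⟩ := exists_inPlane_slot_ge_sin A₁ hν hmenu hlt
  have hup : (13 / 25 : ℝ) ≤ ⟪A₁ w, e⟫_ℝ := htilt.trans hwe
  -- the twin as a one-letter word over the model normal `μ = A₁⁻¹ ν`
  set μ : EuclideanSpace ℝ (Fin 3) := A₁.symm ν with hμ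
  have hμu : ‖μ‖ = 1 := by rw [hμ, LinearIsometryEquiv.norm_map, hν]
  have hμm : ∀ w ∈ fccSlots, ⟪w, μ⟫_ℝ = 0 ∨ ⟪w, μ⟫_ℝ = Real.sqrt (2 / 3) ∨ ⟪w, μ⟫_ℝ = -Real.sqrt (2 / 3) := by
    intro w' hw'
    rw [hμ, ← LinearIsometryEquiv.inner_map_map A₁, LinearIsometryEquiv.apply_symm_apply]
    exact hmenu w' hw'
  have htw : twinFrame A₁ ν = wordFrame A₁ [μ] := by rw [twinFrame_eq_reflection_trans A₁ hν]; rfl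
  have hA₂ : A₂ '' fccStacking 1 (Real.sqrt (2 / 3)) = (wordFrame A₁ [μ]) '' fccStacking 1 (Real.sqrt (2 / 3)) := by
    rw [htwin, htw]
  have hplane : ⟪w, μ⟫_ℝ = 0 := by
    rw [hμ, ← LinearIsometryEquiv.inner_map_map A₁, LinearIsometryEquiv.apply_symm_apply]; exact hwν
  -- charge `(√6/4) sin θ ≤ (√2/2)·⟪A₁ w, e⟫` since `⟪A₁ w, e⟫ ≥ (√3/2) sin θ`
  have h := twoSlabLedger_twin_of_sin_le hs₀ hcert hfar A₁ t₁ A₂ t₂ ⟨hμu, hμm⟩ hA₂ hw hplane hup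
    (s := Real.sqrt 6 / 2 * Real.sqrt (1 - ⟪ν, e⟫_ℝ ^ 2)) ?_
  · have e1 : 1 / 2 * (Real.sqrt 6 / 2 * Real.sqrt (1 - ⟪ν, e⟫_ℝ ^ 2)) =
        Real.sqrt 6 / 4 * Real.sqrt (1 - ⟪ν, e⟫_ℝ ^ 2) := by ring
    rw [e1] at h; exact h
  · have h6 : Real.sqrt 6 = Real.sqrt 2 * Real.sqrt 3 := by
      rw [← Real.sqrt_mul (by norm_num : (0:ℝ) ≤ 2)]; norm_num
    rw [h6]
    have hs2 : 0 ≤ Real.sqrt 2 := Real.sqrt_nonneg 2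
    have := mul_le_mul_of_nonneg_left hwe hs2
    nlinarith [this]

open scoped Classical in
/-- **Lane F's stub inequality for tilted twin pairs, arbitrary fillings.**  A co-axial pair with DIFFERENT linear lattices
is a mirror twin about a unit menu normal `ν` of grain 1, and whenever `(√3/2)·√(1 − ⟪ν,e₃⟫²) ≥ 13/25` the clamped-cell
inequality holds at lane F's charge `½·√(1 − ⟪ν,e₃⟫²)`, modulo `ExactOnly`(C12-55) and `StarPairFar`. -/
theorem coaxialTwin_twoSlabLedger_half_sin
    {s₀ : EuclideanSpace ℝ (Fin 3)} (hs₀ : s₀ ∈ fccSlots)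
    (hcert : ExactOnly 0 (fccSlots.filter fun w => 0 < ⟪w, s₀⟫_ℝ)) (hfar : StarPairFar)
    (A₁ : EuclideanSpace ℝ (Fin 3) ≃ₗᵢ[ℝ] EuclideanSpace ℝ (Fin 3)) (t₁ : EuclideanSpace ℝ (Fin 3))
    (A₂ : EuclideanSpace ℝ (Fin 3) ≃ₗᵢ[ℝ] EuclideanSpace ℝ (Fin 3)) (t₂ : EuclideanSpace ℝ (Fin 3))
    (hco : ∃ (L : EuclideanSpace ℝ (Fin 3) ≃ₗᵢ[ℝ] EuclideanSpace ℝ (Fin 3))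
        (s₁ s₂ : EuclideanSpace ℝ (Fin 3)) (σ σ' : ℤ → ℤ), IsHaggSeq σ ∧ IsHaggSeq σ' ∧
        (fun p => A₁ p + t₁) '' fccStacking 1 (Real.sqrt (2 / 3)) ⊆
          (fun p => L p + s₁) '' barlowStacking 1 (Real.sqrt (2 / 3)) σ ∧
        (fun p => A₂ p + t₂) '' fccStacking 1 (Real.sqrt (2 / 3)) ⊆
          (fun p => L p + s₂) '' barlowStacking 1 (Real.sqrt (2 / 3)) σ')
    (hne : A₁ '' fccStacking 1 (Real.sqrt (2 / 3)) ≠ A₂ '' fccStacking 1 (Real.sqrt (2 / 3))) :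
    ∃ ν : EuclideanSpace ℝ (Fin 3), ‖ν‖ = 1 ∧
      (∀ w ∈ fccSlots, ⟪A₁ w, ν⟫_ℝ = 0 ∨ ⟪A₁ w, ν⟫_ℝ = Real.sqrt (2 / 3) ∨ ⟪A₁ w, ν⟫_ℝ = -Real.sqrt (2 / 3)) ∧
      A₂ '' fccStacking 1 (Real.sqrt (2 / 3)) = twinFrame A₁ ν '' fccStacking 1 (Real.sqrt (2 / 3)) ∧
      ((13 / 25 : ℝ) ≤ Real.sqrt 3 / 2 * Real.sqrt (1 - ⟪ν, EuclideanSpace.single (2 : Fin 3) (1 : ℝ)⟫_ℝ ^ 2) →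
        TwoSlabLedgerAt (1 / 2 * Real.sqrt (1 - ⟪ν, EuclideanSpace.single (2 : Fin 3) (1 : ℝ)⟫_ℝ ^ 2)) A₁ t₁ A₂ t₂) := by
  obtain ⟨ν, hν, hmenu, htwin, hcell⟩ := coaxialTwin_twoSlabLedger_sharp hs₀ hcert hfar A₁ t₁ A₂ t₂ hco hne
  refine ⟨ν, hν, hmenu, htwin, fun htilt => twoSlabLedgerAt_mono ?_ (hcell htilt)⟩
  have hsq0 : 0 ≤ Real.sqrt (1 - ⟪ν, EuclideanSpace.single (2 : Fin 3) (1 : ℝ)⟫_ℝ ^ 2) := Real.sqrt_nonneg _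
  have h6 : (2 : ℝ) ≤ Real.sqrt 6 := by
    rw [show (2 : ℝ) = Real.sqrt (2 ^ 2) by rw [Real.sqrt_sq (by norm_num)]]
    exact Real.sqrt_le_sqrt (by norm_num)
  nlinarith

end Summit.Ventures.Crystal3D.Theorems

end
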